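import Summits.CriticalPhenomena.PercolationContinuityZ3.Theorems.PercNearOneGluingNoHeavyQuantThreeRootBlockFamily
import HarnessLib

/-!
# QUANT lane R8, T-DEC: EXPLICIT REGIMES OF THE BLOCK FAMILY and THE TIED GATE STEP FOR ROOT GATES `p ≤ 2/3` (census-2 g71, TIED3-G71 §0.4)

builds on p205010 (kernel theorem, internal audit signed; external expert review pending)

Support file (`--supports stmt-CriticalPhenomena-4575`), QUANT lane seat prim-quant-census-2 (gen 71).  Theorems only, standard axioms, no sorries.
Sequel of `…QuantThreeRootBlockFamily` (`decAt_threeRootBlock_of_oracle`).  Same binder throughout (three siblings `gate_p ρᵢ` with a COMMON root gate and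
EQUAL opened means, inside `GateStepN`'s oracle binder); `s = ap`.

* `decAt_threeRootBlock_regimeII`: weights `wB = p²`, `wA2 = (1−p)²/(1−3s/2)`, `wA = ((1−p²)(1−3s/2) − (1−p)²)/(1−3s/2)` — valid iff `3a(1+p) ≤ 4`
  (`sdecUpTo_threeRootBlock_II`: `SDECUpTo x a₀` for `3a₀(1+p) ≤ 4`).
* `decAt_threeRootBlock_regimeIV`: `wC = 3p(1−p)(3a(1+p)−4)/((1−s)(9s−4))`, `wB = p²(s − (3a−2)²)/((1−s)(9s−4))`, `wA2 = 4(1−p)(2p−1)/(9s−4)` —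
  valid for `p ≥ 1/2`, `9s > 4`, `3a(1+p) ≥ 4`, `(3a−2)² ≤ s`.
* `decAt_threeRootBlock_regimeIII`: `wP = ((3a−2)² − s)/(a²(1−s))`, `wC = 3p(1−a)(3a−1)/(a(1−s))`, `wA2 = 4(2a−1)(1−a)/a²` — valid for `a ≥ 1/2`, `s ≤ (3a−2)²`.
* **`sdecUpTo_threeRootBlock`**: for every `a₀ ≤ 1` with `3a₀p ≤ 2`, `SDECUpTo x a₀` (case split II / III / IV; the three regimes tile `(0, min(1, 2/(3p))]`).
* **`sdec_threeRootBlock_of_le_twoThirds`**: for `p ≤ 2/3` the tied three-sibling forest is `SDEC x` — the `GateStepN` instance "two tied trees beside a third,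
  equal opened means, common root gate ≤ 2/3" holds by explicit mixtures at EVERY outer gate.  (For `p > 2/3` the range `a ≤ 2/(3p)` is sharp at pattern
  level: TIED3-G71 §0.4 — larger outer gates need count-level certificates.)

HONEST STATUS.  `GateStepN`, `GateStepNCore`, `FarTreeRow` remain OPEN (this is one sub-family of the open core; unequal opened means / unequal root gates
/ `a > 2/(3p)` are not covered).  RATE class (log\*) and the honest sentence of `run/shared/lean/prim/quant/README.md` unchanged.  [this work].  Nothing
here is a published result.  The gluing rows served [cite: KozmaNitzan2024, Conjecture 3 (p. 15)]; product measure [cite: Grimmett1999, §1.3 p. 10].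
-/

noncomputable section

namespace Summit.CriticalPhenomena.PercolationContinuityZ3.Theorems

namespace Quant

open Finset

namespace LawDec

/-- **REGIME II (closed form).**  Weights `wB = p²`, `wA2 = (1−p)²/(1−3s/2)`, `wA = ((1−p²)(1−3s/2) − (1−p)²)/(1−3s/2)`, `wC = wP = 0`; valid when
`3ap < 2` and `(1−p)² ≤ (1−p²)(1−3ap/2)` (⟺ `3a(1+p) ≤ 4`). [this work] -/
theorem decAt_threeRootBlock_regimeII (n : ℕ) (x p a : ℝ) (n₁ n₂ n₃ M₁ M₂ M₃ : ℕ) (ρ₁ ρ₂ ρ₃ : ℕ → ℝ)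
    (hO : ∀ (x' : ℝ) (n' M' : ℕ) (μ' : ℕ → ℝ), n' < n → TreeBuiltN x' n' M' μ' → SDEC x' M' μ')
    (hn : n₁ + n₂ + n₃ + 3 ≤ n) (hx0 : 0 < x) (hxp : x < p) (hp1 : p < 1)
    (hM₁ : 0 < M₁) (hM₂ : 0 < M₂) (hM₃ : 0 < M₃)
    (hρ₁ : TreeBuiltN (x / p) n₁ M₁ ρ₁) (hρ₂ : TreeBuiltN (x / p) n₂ M₂ ρ₂) (hρ₃ : TreeBuiltN (x / p) n₃ M₃ ρ₃)
    (hR₁₂ : ∑ h ∈ Finset.range (M₁ + 1), (h : ℝ) * ρ₁ h = ∑ h ∈ Finset.range (M₂ + 1), (h : ℝ) * ρ₂ h)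
    (hR₁₃ : ∑ h ∈ Finset.range (M₁ + 1), (h : ℝ) * ρ₁ h = ∑ h ∈ Finset.range (M₃ + 1), (h : ℝ) * ρ₃ h)
    (ha0 : 0 < a) (ha1 : a ≤ 1) (har : 3 * (a * p) < 2)
    (hII : (1 - p) ^ 2 ≤ (1 - p ^ 2) * (1 - 3 * (a * p) / 2))
    (j : ℕ) (hj : j < M₁ + M₂ + M₃) :
    DECAt (a * x) j (M₁ + M₂ + M₃) (gate (lconv (M₁ + M₂) M₃ (lconv M₁ M₂ (gate ρ₁ p) (gate ρ₂ p)) (gate ρ₃ p)) a) := by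
  have hr1 : 0 < 1 - 3 * (a * p) / 2 := by linarith only [har]
  have h2 : 2 - a * p * 3 ≠ 0 := by
    intro h
    linarith only [har, h]
  have h2' : 2 - p * a * 3 ≠ 0 := by
    intro h
    linarith only [har, h]
  refine decAt_threeRootBlock_of_oracle n x p a
    (((1 - p ^ 2) * (1 - 3 * (a * p) / 2) - (1 - p) ^ 2) / (1 - 3 * (a * p) / 2))
    ((1 - p) ^ 2 / (1 - 3 * (a * p) / 2)) (p ^ 2) 0 0 n₁ n₂ n₃ M₁ M₂ M₃ ρ₁ ρ₂ ρ₃ hO hn hx0 hxp hp1 hM₁ hM₂ hM₃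
    hρ₁ hρ₂ hρ₃ hR₁₂ hR₁₃ ha0 ha1 har.le (div_nonneg (sub_nonneg.2 hII) hr1.le) (div_nonneg (sq_nonneg _) hr1.le)
    (sq_nonneg _) le_rfl le_rfl ?_ ?_ ?_ ?_ j hj
  · field_simp
    ring
  · field_simp
    ring
  · field_simp
    ring
  · ring

/-- **REGIME II IN `SDECUpTo` FORM.**  Three siblings with a common root gate `p` and equal opened means are gate-stably DEC for EVERY outer
gate `a ≤ a₀` whenever `a₀ ≤ 1` and `3a₀(1+p) ≤ 4` (i.e. `a₀ ≤ 4/(3(1+p))`): regime II's weights are nonnegative there. [this work] -/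
theorem sdecUpTo_threeRootBlock_II (n : ℕ) (x p a₀ : ℝ) (n₁ n₂ n₃ M₁ M₂ M₃ : ℕ) (ρ₁ ρ₂ ρ₃ : ℕ → ℝ)
    (hO : ∀ (x' : ℝ) (n' M' : ℕ) (μ' : ℕ → ℝ), n' < n → TreeBuiltN x' n' M' μ' → SDEC x' M' μ')
    (hn : n₁ + n₂ + n₃ + 3 ≤ n) (hx0 : 0 < x) (hxp : x < p) (hp1 : p < 1)
    (hM₁ : 0 < M₁) (hM₂ : 0 < M₂) (hM₃ : 0 < M₃)
    (hρ₁ : TreeBuiltN (x / p) n₁ M₁ ρ₁) (hρ₂ : TreeBuiltN (x / p) n₂ M₂ ρ₂) (hρ₃ : TreeBuiltN (x / p) n₃ M₃ ρ₃)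
    (hR₁₂ : ∑ h ∈ Finset.range (M₁ + 1), (h : ℝ) * ρ₁ h = ∑ h ∈ Finset.range (M₂ + 1), (h : ℝ) * ρ₂ h)
    (hR₁₃ : ∑ h ∈ Finset.range (M₁ + 1), (h : ℝ) * ρ₁ h = ∑ h ∈ Finset.range (M₃ + 1), (h : ℝ) * ρ₃ h)
    (ha₀1 : a₀ ≤ 1) (ha₀ : a₀ * (3 * (1 + p)) ≤ 4) :
    SDECUpTo x a₀ (M₁ + M₂ + M₃) (lconv (M₁ + M₂) M₃ (lconv M₁ M₂ (gate ρ₁ p) (gate ρ₂ p)) (gate ρ₃ p)) := by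
  intro a ha0 haa j hj
  have hp0 : 0 < p := lt_trans hx0 hxp
  have h0 : a * (3 * (1 + p)) ≤ 4 := le_trans (mul_le_mul_of_nonneg_right haa (by linarith only [hp0])) ha₀
  have h1 : 3 * (a * p) * (1 + p) ≤ 4 * p := by nlinarith [mul_le_mul_of_nonneg_right h0 hp0.le]
  have har : 3 * (a * p) < 2 := by
    by_contra hc
    rw [not_lt] at hc
    nlinarith [mul_le_mul_of_nonneg_right hc (by linarith only [hp0] : (0 : ℝ) ≤ 1 + p), h1, hp1]
  have hII : (1 - p) ^ 2 ≤ (1 - p ^ 2) * (1 - 3 * (a * p) / 2) := by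
    have key : (1 - p ^ 2) * (1 - 3 * (a * p) / 2) - (1 - p) ^ 2 = (1 - p) * p * (4 - a * (3 * (1 + p))) / 2 := by ring
    have : 0 ≤ (1 - p) * p * (4 - a * (3 * (1 + p))) / 2 :=
      div_nonneg (mul_nonneg (mul_nonneg (sub_nonneg.2 hp1.le) hp0.le) (sub_nonneg.2 h0)) (by norm_num)
    linarith only [key, this]
  exact decAt_threeRootBlock_regimeII n x p a n₁ n₂ n₃ M₁ M₂ M₃ ρ₁ ρ₂ ρ₃ hO hn hx0 hxp hp1 hM₁ hM₂ hM₃ hρ₁ hρ₂ hρ₃ hR₁₂ hR₁₃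
    ha0 (haa.trans ha₀1) har hII j hj

/-- **REGIME IV (closed form).**  Weights `wC = 3p(1−p)(3a(1+p)−4)/((1−ap)(9ap−4))`, `wB = p²(ap − (3a−2)²)/((1−ap)(9ap−4))`,
`wA2 = 4(1−p)(2p−1)/(9ap−4)`, valid for `p ≥ 1/2`, `9ap > 4`, `3a(1+p) ≥ 4`, `(3a−2)² ≤ ap`, `3ap ≤ 2`. [this work] -/
theorem decAt_threeRootBlock_regimeIV (n : ℕ) (x p a : ℝ) (n₁ n₂ n₃ M₁ M₂ M₃ : ℕ) (ρ₁ ρ₂ ρ₃ : ℕ → ℝ)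
    (hO : ∀ (x' : ℝ) (n' M' : ℕ) (μ' : ℕ → ℝ), n' < n → TreeBuiltN x' n' M' μ' → SDEC x' M' μ')
    (hn : n₁ + n₂ + n₃ + 3 ≤ n) (hx0 : 0 < x) (hxp : x < p) (hp1 : p < 1)
    (hM₁ : 0 < M₁) (hM₂ : 0 < M₂) (hM₃ : 0 < M₃)
    (hρ₁ : TreeBuiltN (x / p) n₁ M₁ ρ₁) (hρ₂ : TreeBuiltN (x / p) n₂ M₂ ρ₂) (hρ₃ : TreeBuiltN (x / p) n₃ M₃ ρ₃)
    (hR₁₂ : ∑ h ∈ Finset.range (M₁ + 1), (h : ℝ) * ρ₁ h = ∑ h ∈ Finset.range (M₂ + 1), (h : ℝ) * ρ₂ h)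
    (hR₁₃ : ∑ h ∈ Finset.range (M₁ + 1), (h : ℝ) * ρ₁ h = ∑ h ∈ Finset.range (M₃ + 1), (h : ℝ) * ρ₃ h)
    (ha0 : 0 < a) (ha1 : a ≤ 1) (har : 3 * (a * p) ≤ 2) (hp2 : 1 / 2 ≤ p) (h94 : 4 < 9 * (a * p))
    (h4 : 4 ≤ a * (3 * (1 + p))) (hsq : (3 * a - 2) ^ 2 ≤ a * p)
    (j : ℕ) (hj : j < M₁ + M₂ + M₃) :
    DECAt (a * x) j (M₁ + M₂ + M₃) (gate (lconv (M₁ + M₂) M₃ (lconv M₁ M₂ (gate ρ₁ p) (gate ρ₂ p)) (gate ρ₃ p)) a) := by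
  have hp0 : 0 < p := lt_trans hx0 hxp
  have hs1 : 0 < 1 - a * p := by nlinarith [mul_le_of_le_one_left hp0.le ha1]
  have hD : 0 < 9 * (a * p) - 4 := by linarith only [h94]
  have hD1 : 9 * (a * p) - 4 ≠ 0 := hD.ne'
  have hD2 : a * p * 9 - 4 ≠ 0 := by intro h; apply hD1; linarith only [h]
  have hD3 : p * a * 9 - 4 ≠ 0 := by intro h; apply hD1; linarith only [h]
  have hs1' : 1 - a * p ≠ 0 := hs1.ne'
  have hs2 : 1 - p * a ≠ 0 := by intro h; apply hs1'; linarith only [h]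
  refine decAt_threeRootBlock_of_oracle n x p a 0 (4 * (1 - p) * (2 * p - 1) / (9 * (a * p) - 4))
    (p ^ 2 * (a * p - (3 * a - 2) ^ 2) / ((1 - a * p) * (9 * (a * p) - 4)))
    (3 * p * (1 - p) * (a * (3 * (1 + p)) - 4) / ((1 - a * p) * (9 * (a * p) - 4))) 0
    n₁ n₂ n₃ M₁ M₂ M₃ ρ₁ ρ₂ ρ₃ hO hn hx0 hxp hp1 hM₁ hM₂ hM₃ hρ₁ hρ₂ hρ₃ hR₁₂ hR₁₃ ha0 ha1 har le_rfl
    (div_nonneg (mul_nonneg (mul_nonneg (by norm_num) (sub_nonneg.2 hp1.le)) (by linarith only [hp2])) hD.le)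
    (div_nonneg (mul_nonneg (sq_nonneg _) (sub_nonneg.2 hsq)) (mul_pos hs1 hD).le)
    (div_nonneg (mul_nonneg (mul_nonneg (mul_nonneg (by norm_num) hp0.le) (sub_nonneg.2 hp1.le)) (sub_nonneg.2 h4))
      (mul_pos hs1 hD).le)
    le_rfl ?_ ?_ ?_ ?_ j hj
  · field_simp
    ring
  · field_simp
    ring
  · field_simp
    ring
  · field_simp
    ring

/-- **REGIME III (closed form).**  Weights `wP = ((3a−2)² − ap)/(a²(1−ap))`, `wC = 3p(1−a)(3a−1)/(a(1−ap))`, `wA2 = 4(2a−1)(1−a)/a²`,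
valid for `1/2 ≤ a ≤ 1`, `ap ≤ (3a−2)²`, `3ap ≤ 2`. [this work] -/
theorem decAt_threeRootBlock_regimeIII (n : ℕ) (x p a : ℝ) (n₁ n₂ n₃ M₁ M₂ M₃ : ℕ) (ρ₁ ρ₂ ρ₃ : ℕ → ℝ)
    (hO : ∀ (x' : ℝ) (n' M' : ℕ) (μ' : ℕ → ℝ), n' < n → TreeBuiltN x' n' M' μ' → SDEC x' M' μ')
    (hn : n₁ + n₂ + n₃ + 3 ≤ n) (hx0 : 0 < x) (hxp : x < p) (hp1 : p < 1)
    (hM₁ : 0 < M₁) (hM₂ : 0 < M₂) (hM₃ : 0 < M₃)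
    (hρ₁ : TreeBuiltN (x / p) n₁ M₁ ρ₁) (hρ₂ : TreeBuiltN (x / p) n₂ M₂ ρ₂) (hρ₃ : TreeBuiltN (x / p) n₃ M₃ ρ₃)
    (hR₁₂ : ∑ h ∈ Finset.range (M₁ + 1), (h : ℝ) * ρ₁ h = ∑ h ∈ Finset.range (M₂ + 1), (h : ℝ) * ρ₂ h)
    (hR₁₃ : ∑ h ∈ Finset.range (M₁ + 1), (h : ℝ) * ρ₁ h = ∑ h ∈ Finset.range (M₃ + 1), (h : ℝ) * ρ₃ h)
    (ha0 : 0 < a) (ha1 : a ≤ 1) (har : 3 * (a * p) ≤ 2) (ha2 : 1 / 2 ≤ a) (hsq : a * p ≤ (3 * a - 2) ^ 2)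
    (j : ℕ) (hj : j < M₁ + M₂ + M₃) :
    DECAt (a * x) j (M₁ + M₂ + M₃) (gate (lconv (M₁ + M₂) M₃ (lconv M₁ M₂ (gate ρ₁ p) (gate ρ₂ p)) (gate ρ₃ p)) a) := by
  have hp0 : 0 < p := lt_trans hx0 hxp
  have hs1 : 0 < 1 - a * p := by nlinarith [mul_le_of_le_one_left hp0.le ha1]
  have hs1' : 1 - a * p ≠ 0 := hs1.ne'
  have hs2 : 1 - p * a ≠ 0 := by intro h; apply hs1'; linarith only [h]
  have ha0' : a ≠ 0 := ha0.ne'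
  refine decAt_threeRootBlock_of_oracle n x p a 0 (4 * (2 * a - 1) * (1 - a) / a ^ 2) 0
    (3 * p * (1 - a) * (3 * a - 1) / (a * (1 - a * p))) (((3 * a - 2) ^ 2 - a * p) / (a ^ 2 * (1 - a * p)))
    n₁ n₂ n₃ M₁ M₂ M₃ ρ₁ ρ₂ ρ₃ hO hn hx0 hxp hp1 hM₁ hM₂ hM₃ hρ₁ hρ₂ hρ₃ hR₁₂ hR₁₃ ha0 ha1 har le_rfl
    (div_nonneg (mul_nonneg (mul_nonneg (by norm_num) (by linarith only [ha2])) (sub_nonneg.2 ha1)) (sq_nonneg _)) le_rfl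
    (div_nonneg (mul_nonneg (mul_nonneg (mul_nonneg (by norm_num) hp0.le) (sub_nonneg.2 ha1)) (by linarith only [ha2]))
      (mul_pos ha0 hs1).le)
    (div_nonneg (sub_nonneg.2 hsq) (mul_pos (pow_pos ha0 2) hs1).le) ?_ ?_ ?_ ?_ j hj
  · field_simp
    ring
  · field_simp
    ring
  · field_simp
    ring
  · field_simp
    ring

/-- **THE THREE-SIBLING GATE STEP FOR ALL OUTER GATES UP TO `2/(3p)` (equal opened means, common root gate).**  `SDECUpTo x a₀` for every
`a₀ ≤ 1` with `3a₀p ≤ 2`: regime II when `3a(1+p) ≤ 4`, else regime III when `ap ≤ (3a−2)²`, else regime IV.  In particular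
(`sdec_threeRootBlock_of_le_twoThirds`) for `p ≤ 2/3` the tied forest is SDEC at EVERY outer gate. [this work] -/
theorem sdecUpTo_threeRootBlock (n : ℕ) (x p a₀ : ℝ) (n₁ n₂ n₃ M₁ M₂ M₃ : ℕ) (ρ₁ ρ₂ ρ₃ : ℕ → ℝ)
    (hO : ∀ (x' : ℝ) (n' M' : ℕ) (μ' : ℕ → ℝ), n' < n → TreeBuiltN x' n' M' μ' → SDEC x' M' μ')
    (hn : n₁ + n₂ + n₃ + 3 ≤ n) (hx0 : 0 < x) (hxp : x < p) (hp1 : p < 1)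
    (hM₁ : 0 < M₁) (hM₂ : 0 < M₂) (hM₃ : 0 < M₃)
    (hρ₁ : TreeBuiltN (x / p) n₁ M₁ ρ₁) (hρ₂ : TreeBuiltN (x / p) n₂ M₂ ρ₂) (hρ₃ : TreeBuiltN (x / p) n₃ M₃ ρ₃)
    (hR₁₂ : ∑ h ∈ Finset.range (M₁ + 1), (h : ℝ) * ρ₁ h = ∑ h ∈ Finset.range (M₂ + 1), (h : ℝ) * ρ₂ h)
    (hR₁₃ : ∑ h ∈ Finset.range (M₁ + 1), (h : ℝ) * ρ₁ h = ∑ h ∈ Finset.range (M₃ + 1), (h : ℝ) * ρ₃ h)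
    (ha₀1 : a₀ ≤ 1) (ha₀ : 3 * (a₀ * p) ≤ 2) :
    SDECUpTo x a₀ (M₁ + M₂ + M₃) (lconv (M₁ + M₂) M₃ (lconv M₁ M₂ (gate ρ₁ p) (gate ρ₂ p)) (gate ρ₃ p)) := by
  intro a ha0 haa j hj
  have hp0 : 0 < p := lt_trans hx0 hxp
  have ha1 : a ≤ 1 := haa.trans ha₀1
  have har : 3 * (a * p) ≤ 2 := le_trans (by nlinarith [mul_le_mul_of_nonneg_right haa hp0.le]) ha₀
  by_cases hc1 : a * (3 * (1 + p)) ≤ 4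
  · exact sdecUpTo_threeRootBlock_II n x p a n₁ n₂ n₃ M₁ M₂ M₃ ρ₁ ρ₂ ρ₃ hO hn hx0 hxp hp1 hM₁ hM₂ hM₃ hρ₁ hρ₂ hρ₃ hR₁₂ hR₁₃
      ha1 hc1 a ha0 le_rfl j hj
  rw [not_le] at hc1
  have ha23 : 2 / 3 < a := by nlinarith [mul_le_mul_of_nonneg_left hp1.le ha0.le]
  by_cases hc2 : a * p ≤ (3 * a - 2) ^ 2
  · exact decAt_threeRootBlock_regimeIII n x p a n₁ n₂ n₃ M₁ M₂ M₃ ρ₁ ρ₂ ρ₃ hO hn hx0 hxp hp1 hM₁ hM₂ hM₃ hρ₁ hρ₂ hρ₃ hR₁₂ hR₁₃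
      ha0 ha1 har (by linarith only [ha23]) hc2 j hj
  rw [not_le] at hc2
  have hp2 : 1 / 2 ≤ p := by
    by_contra hp
    rw [not_le] at hp
    -- then `a > 8/9` and `(3a−2)² − ap ≥ (3a−2)² − a/2 = (2a−1)(9a−8)/2 ≥ 0`
    have ha89 : 8 / 9 < a := by nlinarith [mul_le_mul_of_nonneg_left hp.le ha0.le]
    have key : (3 * a - 2) ^ 2 - a / 2 = (2 * a - 1) * (9 * a - 8) / 2 := by ring
    have h1 : 0 ≤ (2 * a - 1) * (9 * a - 8) / 2 :=
      div_nonneg (mul_nonneg (by linarith only [ha89]) (by linarith only [ha89])) (by norm_num)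
    nlinarith [mul_le_mul_of_nonneg_left hp.le ha0.le, key, h1, hc2]
  have h94 : 4 < 9 * (a * p) := by nlinarith [mul_le_mul_of_nonneg_left hp2 ha0.le]
  exact decAt_threeRootBlock_regimeIV n x p a n₁ n₂ n₃ M₁ M₂ M₃ ρ₁ ρ₂ ρ₃ hO hn hx0 hxp hp1 hM₁ hM₂ hM₃ hρ₁ hρ₂ hρ₃ hR₁₂ hR₁₃
    ha0 ha1 har hp2 h94 hc1.le hc2.le j hj

/-- **THE TIED GATE STEP IS A THEOREM FOR ROOT GATES `p ≤ 2/3` (equal opened means).**  Inside `GateStepN`'s binder: three siblings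
`gate_p ρᵢ` with a common root gate `p ≤ 2/3` and equal opened means (e.g. three identical composite siblings — the numerically hardest
'tied' corner of the RCM census, LEAD-NOTES-G42 N7/N8) form an SDEC forest at the floor `x`, for EVERY outer gate.  The first sub-family of
the open core (README V393/V400: ≥ 3 composite siblings under a gate) settled by explicit mixtures at all outer gates. [this work] -/
theorem sdec_threeRootBlock_of_le_twoThirds (n : ℕ) (x p : ℝ) (n₁ n₂ n₃ M₁ M₂ M₃ : ℕ) (ρ₁ ρ₂ ρ₃ : ℕ → ℝ)
    (hO : ∀ (x' : ℝ) (n' M' : ℕ) (μ' : ℕ → ℝ), n' < n → TreeBuiltN x' n' M' μ' → SDEC x' M' μ')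
    (hn : n₁ + n₂ + n₃ + 3 ≤ n) (hx0 : 0 < x) (hxp : x < p) (hp : p ≤ 2 / 3)
    (hM₁ : 0 < M₁) (hM₂ : 0 < M₂) (hM₃ : 0 < M₃)
    (hρ₁ : TreeBuiltN (x / p) n₁ M₁ ρ₁) (hρ₂ : TreeBuiltN (x / p) n₂ M₂ ρ₂) (hρ₃ : TreeBuiltN (x / p) n₃ M₃ ρ₃)
    (hR₁₂ : ∑ h ∈ Finset.range (M₁ + 1), (h : ℝ) * ρ₁ h = ∑ h ∈ Finset.range (M₂ + 1), (h : ℝ) * ρ₂ h)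
    (hR₁₃ : ∑ h ∈ Finset.range (M₁ + 1), (h : ℝ) * ρ₁ h = ∑ h ∈ Finset.range (M₃ + 1), (h : ℝ) * ρ₃ h) :
    SDEC x (M₁ + M₂ + M₃) (lconv (M₁ + M₂) M₃ (lconv M₁ M₂ (gate ρ₁ p) (gate ρ₂ p)) (gate ρ₃ p)) := by
  intro a ha0 ha1 j hj
  exact sdecUpTo_threeRootBlock n x p 1 n₁ n₂ n₃ M₁ M₂ M₃ ρ₁ ρ₂ ρ₃ hO hn hx0 hxp (by linarith only [hp]) hM₁ hM₂ hM₃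
    hρ₁ hρ₂ hρ₃ hR₁₂ hR₁₃ le_rfl (by linarith only [hp]) a ha0 ha1 j hj

end LawDec

end Quant

end Summit.CriticalPhenomena.PercolationContinuityZ3.Theorems
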